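import Summits.Ventures.PercRepro0.PlanarClose
import Summits.Ventures.PercRepro0.HighDClose
import Summits.Ventures.PercRepro0.PcChi
import Summits.Ventures.PercRepro0.TrifCreate
import Summits.Ventures.PercRepro0.Sharpness

/-!
# LEAN CERTIFICATE of the declared PARTIAL PROOF — version 3: unconditional modulo the print (seat p3)

Version 2 (`CertificateV2.lean`, DECLARATION LEAN CERTIFICATE 2026-08-26T01:43:11Z) concluded the declared
content `T2_Planar ∧ THD` from four hypotheses: the published H1 (at the print's `p_c^χ`) and the three
paper-proved statements P3 · UNIQUE, P1 · HARRIS, P5 · SHARPNESS.  Since then the three paper-proved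
statements have been kernel-checked on the cell's definitions by their owners:

* P3 · UNIQUE: `TrifCreate.P3_Unique_all : ∀ d, P3_Unique d` (p6, Burton–Keane on `Defs`);
* P5 · SHARPNESS: `Sharp.P5_Sharpness_holds' : ∀ d, P5_Sharpness d` (p4, Theorems S1–S2 on `Defs`);
* P1 · HARRIS: `Zhang.P1_Harris_of ZhangSeparation.zhangSeparation_holds (TrifCreate.P3_Unique_all 2)`
  (p2's Zhang skeleton with p1's separation lemma) — packaged with the planar assembly as
  `PlanarClose.T2_Planar_holds : T2_Planar` (p1).

This file composes them: ONE hypothesis is left, the print.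

* `P3_Unique_holds`, `P1_Harris_holds`, `P5_Sharpness_holds` — the three discharged route statements, by name;
* `T2_Planar_holds` — `θ_2(p_c(2)) = 0 ∧ p_c(2) = ½`, no hypothesis;
* `THD_of_print` — `∀ d ≥ 11, θ_d(p_c(d)) = 0` from `hH1χ` alone;
* `partialProof_of_print (hH1χ : PcChi.H1_TriangleChi11) : T2_Planar ∧ THD` — the certificate;
* `target_of_print (hH1χ) (hMID : TMID) : Target` — the brief's target given the residual;
* `target_iff_TMID (hH1χ) : Target ↔ TMID` — modulo the print, the brief is exactly the residual.

Hypothesis left: `hH1χ : PcChi.H1_TriangleChi11` — H1 · TRIANGLE-11, PUBLISHED, applied verbatim: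
Fitzner–van der Hofstad 2017, Corollary 1.3 with (1.4), the triangle condition at the print's own
`p_c^χ(d) = sup{p : χ_d(p) < ∞}` for every `d ≥ 11` (lit-2 typing e6c90240); a print stays a hypothesis.
Transported to the route's `p_c = inf{θ > 0}` by `PcChi.H1_Triangle11_of_chi` with the now
kernel-checked sharpness.  No definitions; no axioms beyond the standard three; this file claims nothing
beyond DECLARATION PARTIAL PROOF (2026-08-25T23:22:09Z).
-/

namespace Summit.Ventures.PercRepro0.CertificateV3

open Summit.Ventures.PercRepro0.Defs

/-- P3 · UNIQUE holds in every dimension (p6's `TrifCreate.P3_Unique_all`). -/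
theorem P3_Unique_holds (d : ℕ) : P3_Unique d := TrifCreate.P3_Unique_all d

/-- P5 · SHARPNESS holds in every dimension (p4's `Sharp.P5_Sharpness_holds'`). -/
theorem P5_Sharpness_holds (d : ℕ) : P5_Sharpness d := Sharp.P5_Sharpness_holds' d

/-- P1 · HARRIS holds: `θ_2(½) = 0` (p2's Zhang skeleton, p1's separation lemma, p6's uniqueness). -/
theorem P1_Harris_holds : P1_Harris :=
  Zhang.P1_Harris_of ZhangSeparation.zhangSeparation_holds (TrifCreate.P3_Unique_all 2)

/-- T2 · PLANAR-ASSEMBLY holds: `θ_2(p_c(2)) = 0 ∧ p_c(2) = ½` (p1's `PlanarClose.T2_Planar_holds`). -/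
theorem T2_Planar_holds : T2_Planar := PlanarClose.T2_Planar_holds

/-- H1 · TRIANGLE-11 at the route's `p_c` from the print's statement at `p_c^χ` (S5 · PC-CHI, now
unconditional through sharpness). -/
theorem H1_Triangle11_of_print (hH1χ : PcChi.H1_TriangleChi11) : H1_Triangle11 :=
  PcChi.H1_Triangle11_of_chi hH1χ fun d _ => P5_Sharpness_holds d

/-- T_HD · HIGH-D from the print alone: `∀ d ≥ 11, θ_d(p_c(d)) = 0`. -/
theorem THD_of_print (hH1χ : PcChi.H1_TriangleChi11) : THD :=
  HighD.THD_of_H1_P3 (H1_Triangle11_of_print hH1χ) P3_Unique_holds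

/-- **The certificate, v3.** One hypothesis — the published H1 at the print's `p_c^χ`; conclusion = the
declared content of DECLARATION PARTIAL PROOF: `T2_Planar ∧ THD`. -/
theorem partialProof_of_print (hH1χ : PcChi.H1_TriangleChi11) : T2_Planar ∧ THD :=
  ⟨T2_Planar_holds, THD_of_print hH1χ⟩

/-- The brief's `Target` from the print plus the residual `TMID` (by `Defs.R0_regime_split`). -/
theorem target_of_print (hH1χ : PcChi.H1_TriangleChi11) (hMID : TMID) : Target :=
  R0_regime_split T2_Planar_holds (THD_of_print hH1χ) hMID

/-- Modulo the print, the brief's `Target` IS the residual: `Target ↔ TMID` (`3 ≤ d ≤ 10`). -/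
theorem target_iff_TMID (hH1χ : PcChi.H1_TriangleChi11) : Target ↔ TMID :=
  ⟨fun h d h3 h10 => h d (by omega), target_of_print hH1χ⟩

end Summit.Ventures.PercRepro0.CertificateV3
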